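import Summits.RiemannHypothesis.RiemannHypothesis.Theorems.WeilFormatCDataA8046Tables
import Summits.RiemannHypothesis.RiemannHypothesis.Theorems.WeilFormatCDataLog3HalfTabValid
import HarnessLib

/-!
# Format C kernel rung `A8046` (a = 4023/5000): validity of the constants, prime data and the table below mode 45 (kernel certificates, part A)

Window `a = 4023/5000` (the ζ FRONTIER `weilPositivityOn_8046`: `e^{2a} = 4.9989 < 5`); prime powers in the window: 2, 3, 4; evaluator parameters S = 2^80, Kpi 70, Kser 96, kred 8, Kexp 24, J 60; full table modes < 130; units 2^-80 (entries), 2^-40 (weights).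
Generated by rh-explicit-weil-grh-2 gen10 with rh-explicit-weil-2 gen5's generator functions UNCHANGED (`#eval` of the tree's `Encl.consts` / `Encl.idxRec`, packed as in HOME/rh-explicit-weil-2/gramgen5); every datum is re-verified by the kernel in the theorem files (`decide +kernel`: recompute + containment). Helper data of the rh-explicit Weil-positivity programme: the ζ-side table consumed by the twisted format-C χ-cells of the GRH arm AT THE FRONTIER (`Summits/Ventures/WeilGRH/CellMod*A8046`), RH-free. [cite: Yoshida1992HermitianForms, §5 (5.15)-(5.16) p. 301; §7 pp. 305–312]
-/

set_option linter.dupNamespace false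
set_option maxRecDepth 200000

namespace Summit.RiemannHypothesis.RiemannHypothesis.Theorems.WeilFormatCData.A8046
open Literature.NumberTheory.LFunctions Literature.NumberTheory.LFunctions.Yoshida1992 Encl Literature.Analysis.ValidatedNumerics.NumericsMP

/-- kernel: `A ∋ a`. -/
theorem tA : checkFrac (2 ^ 80) 4023 5000 A = true := by decide +kernel

/-- kernel: the prime data of the window (strict separation up to kmax = 5: the prime 5 lies OUTSIDE, `2a = 1.6092 < log 5 = 1.6094`). -/
theorem tK : checkPrimeDataSep (2 ^ 80) 96 A 5 ks = true := by decide +kernel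

/-- `a ∈ A` (window written out; `a` unfolds to it). -/
theorem a_mem : MI.mem (2 ^ 80) (((4023 : ℤ) : ℝ) / (5000 : ℕ)) A :=
  mem_of_checkFrac tA

/-- `0 < a` (window written out; `a` unfolds to it). -/
theorem a_pos : (0 : ℝ) < (((4023 : ℤ) : ℝ) / (5000 : ℕ)) := by
  positivity

/-- the constants are valid for `a` (the `π` box is `Log3Half.P`, byte-identical: `Log3Half.pi_mem` REUSED; the constants check inline). -/
theorem consts_valid : ConstsValid (2 ^ 80) (((4023 : ℤ) : ℝ) / (5000 : ℕ)) ks C :=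
  constsValid_of_checkConsts (prm := prm) (by norm_num [prm]) (by norm_num [prm]) Log3Half.pi_mem a_mem (by decide +kernel)

/-- the prime data is valid for `a`. -/
theorem primeData : PrimeData (((4023 : ℤ) : ℝ) / (5000 : ℕ)) ks := primeData_of_checkSep (by norm_num) a_mem tK

/-- kernel: table slice `[0, 10)`. -/
theorem tT0 : checkTable prm C tab 0 10 = true := by decide +kernel

/-- kernel: table slice `[10, 19)`. -/
theorem tT10 : checkTable prm C tab 10 9 = true := by decide +kernel

/-- kernel: table slice `[19, 28)`. -/
theorem tT19 : checkTable prm C tab 19 9 = true := by decide +kernel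

/-- kernel: table slice `[28, 37)`. -/
theorem tT28 : checkTable prm C tab 28 9 = true := by decide +kernel

/-- kernel: table slice `[37, 45)`. -/
theorem tT37 : checkTable prm C tab 37 8 = true := by decide +kernel

/-- the special-value table is valid below `45` (part A). -/
theorem tab_validA : TabValid (2 ^ 80) (((4023 : ℤ) : ℝ) / (5000 : ℕ)) ks 45 tab := by
  have h10 : TabValid (2 ^ 80) a ks (0 + 10) tab :=
    (TabValid.zero (S := 2 ^ 80) (a := a) (ks := ks) (tab := tab)).extend fun n hn hnk ↦ idxValid_of_checkTable (prm := prm) (by norm_num [prm]) a_pos consts_valid tT0 hn hnk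
  have h19 : TabValid (2 ^ 80) a ks (10 + 9) tab :=
    h10.extend fun n hn hnk ↦ idxValid_of_checkTable (prm := prm) (by norm_num [prm]) a_pos consts_valid tT10 hn hnk
  have h28 : TabValid (2 ^ 80) a ks (19 + 9) tab :=
    h19.extend fun n hn hnk ↦ idxValid_of_checkTable (prm := prm) (by norm_num [prm]) a_pos consts_valid tT19 hn hnk
  have h37 : TabValid (2 ^ 80) a ks (28 + 9) tab :=
    h28.extend fun n hn hnk ↦ idxValid_of_checkTable (prm := prm) (by norm_num [prm]) a_pos consts_valid tT28 hn hnk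
  have h45 : TabValid (2 ^ 80) a ks (37 + 8) tab :=
    h37.extend fun n hn hnk ↦ idxValid_of_checkTable (prm := prm) (by norm_num [prm]) a_pos consts_valid tT37 hn hnk
  exact h45

end Summit.RiemannHypothesis.RiemannHypothesis.Theorems.WeilFormatCData.A8046
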